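import Mathlib
import HarnessLib
import Summits.NavierStokesRegularity.NavierStokesRegularity.Theorems.PoloidalWindowDoorPoloidalWindowRigidityZShockCharacteristicRiccati
import Summits.NavierStokesRegularity.NavierStokesRegularity.Theorems.PoloidalWindowDoorPoloidalWindowRigidityZShockGlobalCharacteristics

/-!
# Crux K2 `PoloidalWindowRigidity` (stmt-NavierStokesRegularity-19708), line `z_shock` — RUNG R2 ASSEMBLED FOR ONE FAMILY:
# two-sided Liouville for a Riemann invariant of a genuinely nonlinear diagonal `2 × 2` system

`--supports stmt-NavierStokesRegularity-19708 --as helper` (leafhand-ns-poloidalwindowdoor-1 g0, 2026-08-30).  Class-free,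
Mathlib only.  **No stub and no summit is closed by this file; Navier–Stokes regularity is NOT proved here.**

Rung R2 of `Cruxes/PoloidalWindowRigidity/Lines/z_shock.md` («a two-sided eternal `C¹_b` solution of the AUTONOMOUS genuinely
nonlinear p-system is constant», Lax 1964 / John 1974 read two-sidedly; the 1-D shadow of the deciding stub `stub_zShockThickAut`)
for the `λ`-family of a diagonal system `r_z + λ(r,s) r_x = 0`, `s_z + μ(r,s) s_x = 0` on `ℝ × ℝ` (`z` = first coordinate = the
height, two-sided):

* `transversal_derivative_eq_zero` — if `r ∈ C²`, `s, λ` differentiable, the speed `λ∘(r,s)` is bounded with bounded `x`-derivative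
  (so GLOBAL characteristics exist through every point, `…ZShockGlobalCharacteristics.exists_global_characteristic`), `λ_r ≥ a₀ > 0`
  on the range (GENUINE NONLINEARITY with a sign), and John's integrating factor exists (for every value `r₀` an antiderivative
  `H_f` of `λ_s/(λ − μ)` at fixed `r₀`, bounded by `H` on the values of `s`), then `∂_x r ≡ 0` on `ℝ × ℝ`
  (`…ZShockCharacteristicRiccati.transversal_derivative_eq_zero_along` on the characteristic through each point, after
  `riemannInvariant_const_along` has frozen `r = r₀` there).
* `riemannInvariant_const` — hence, with the equation, `Dr ≡ 0` and `r` is CONSTANT on `ℝ × ℝ`.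

The `μ`-family is the same statement with the roles of `(r, λ)` and `(s, μ)` exchanged.  What is NOT here: the translation from the
p-system `p_z = G'(w) w_x`, `w_z = −p_x` to Riemann invariants (`r, s = p ± K(w)`, `K' = √(−G')`), and the derivation of the
hypotheses (boundedness of the John factor from `C¹_b` bounds and strict hyperbolicity) — bookkeeping left to the R2 assembler.
[folklore]
-/

noncomputable section

namespace Summit.NavierStokesRegularity.NavierStokesRegularity.Theorems.PoloidalWindowDoorPoloidalWindowRigidityZShockRiemannInvariantLiouville

-- the problem directory repeats the summit name (`NavierStokesRegularity/NavierStokesRegularity`)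
set_option linter.dupNamespace false

open Set Filter Topology Function Metric
open scoped NNReal
open Summit.NavierStokesRegularity.NavierStokesRegularity.Theorems.PoloidalWindowDoorPoloidalWindowRigidityZShockCharacteristicRiccati
open Summit.NavierStokesRegularity.NavierStokesRegularity.Theorems.PoloidalWindowDoorPoloidalWindowRigidityZShockGlobalCharacteristics

/-- **R2 for the `λ`-family: the transversal derivative of the Riemann invariant vanishes identically.**  See the module docstring
for the hypotheses (genuine nonlinearity `λ_r ≥ a₀ > 0`; bounded speed with bounded `x`-derivative; John's integrating factor
bounded by `H` on the values of `s`). [folklore] -/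
theorem transversal_derivative_eq_zero {r s : ℝ × ℝ → ℝ} {Λ M : ℝ × ℝ → ℝ} (hr : ContDiff ℝ 2 r)
    (hs : Differentiable ℝ s) (hΛ : Differentiable ℝ Λ)
    (hPDE : ∀ p, fderiv ℝ r p (1, 0) + Λ (r p, s p) * fderiv ℝ r p (0, 1) = 0)
    (hPDEs : ∀ p, fderiv ℝ s p (1, 0) + M (r p, s p) * fderiv ℝ s p (0, 1) = 0)
    {K B : ℝ≥0} (hB : ∀ p : ℝ × ℝ, ‖Λ (r p, s p)‖ ≤ B)
    (hKx : ∀ p : ℝ × ℝ, ‖fderiv ℝ (fun q : ℝ × ℝ => Λ (r q, s q)) p (0, 1)‖ ≤ K)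
    {a₀ : ℝ} (ha₀ : 0 < a₀) (hgnl : ∀ p : ℝ × ℝ, a₀ ≤ fderiv ℝ Λ (r p, s p) (1, 0))
    {H : ℝ} (hJ : ∀ r₀ : ℝ, ∃ Hf Hf' : ℝ → ℝ, (∀ σ, HasDerivAt Hf (Hf' σ) σ) ∧
      (∀ σ, Hf' σ * (Λ (r₀, σ) - M (r₀, σ)) = fderiv ℝ Λ (r₀, σ) (0, 1)) ∧ ∀ p : ℝ × ℝ, |Hf (s p)| ≤ H) :
    ∀ p : ℝ × ℝ, fderiv ℝ r p (0, 1) = 0 := by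
  have hr1 : Differentiable ℝ r := hr.differentiable (by simp)
  -- the speed is differentiable as a function on `ℝ × ℝ`
  have hd : Differentiable ℝ fun p : ℝ × ℝ => Λ (r p, s p) :=
    fun p => (hΛ (r p, s p)).comp p ((hr1 p).prodMk (hs p))
  rintro ⟨z₀, x₀⟩
  -- a global characteristic through `(z₀, x₀)`
  obtain ⟨X, hX0, hX⟩ := exists_global_characteristic hd hB hKx z₀ x₀
  -- `r` is frozen along it
  have hrconst : ∀ z, r (z, X z) = r (z₀, X z₀) := by
    have hD : ∀ z, HasDerivAt (fun t => r (t, X t)) 0 z := riemannInvariant_const_along hr1 hPDE hX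
    intro z
    exact is_const_of_deriv_eq_zero (fun t => (hD t).differentiableAt) (fun t => (hD t).deriv) z z₀
  set r₀ := r (z₀, X z₀) with hr₀
  -- John's integrating factor along the curve
  obtain ⟨Hf, Hf', hHf, hHf', hHb⟩ := hJ r₀
  have hh : ∀ z, HasDerivAt (fun t => Hf (s (t, X t)))
      (fderiv ℝ Λ (r (z, X z), s (z, X z)) (0, 1) * fderiv ℝ s (z, X z) (0, 1)) z :=
    john_factor_hasDerivAt (Λ := Λ) (M := M) hs hPDEs hX hrconst hHf hHf'
  have hzero := transversal_derivative_eq_zero_along (Λ := Λ) hr hs hΛ hPDE hX ha₀ (fun z => hgnl (z, X z))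
    (h := fun t => Hf (s (t, X t)))
    (h' := fun z => fderiv ℝ Λ (r (z, X z), s (z, X z)) (0, 1) * fderiv ℝ s (z, X z) (0, 1))
    hh (fun _ => rfl) (fun z => hHb (z, X z)) z₀
  rwa [hX0] at hzero

/-- **R2 for the `λ`-family, constancy.**  Under the hypotheses of `transversal_derivative_eq_zero`, the Riemann invariant `r` is
CONSTANT on `ℝ × ℝ`: `∂_x r ≡ 0`, hence `∂_z r = −λ ∂_x r ≡ 0`, so `Dr ≡ 0` on the connected plane. [folklore] -/
theorem riemannInvariant_const {r s : ℝ × ℝ → ℝ} {Λ M : ℝ × ℝ → ℝ} (hr : ContDiff ℝ 2 r)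
    (hs : Differentiable ℝ s) (hΛ : Differentiable ℝ Λ)
    (hPDE : ∀ p, fderiv ℝ r p (1, 0) + Λ (r p, s p) * fderiv ℝ r p (0, 1) = 0)
    (hPDEs : ∀ p, fderiv ℝ s p (1, 0) + M (r p, s p) * fderiv ℝ s p (0, 1) = 0)
    {K B : ℝ≥0} (hB : ∀ p : ℝ × ℝ, ‖Λ (r p, s p)‖ ≤ B)
    (hKx : ∀ p : ℝ × ℝ, ‖fderiv ℝ (fun q : ℝ × ℝ => Λ (r q, s q)) p (0, 1)‖ ≤ K)
    {a₀ : ℝ} (ha₀ : 0 < a₀) (hgnl : ∀ p : ℝ × ℝ, a₀ ≤ fderiv ℝ Λ (r p, s p) (1, 0))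
    {H : ℝ} (hJ : ∀ r₀ : ℝ, ∃ Hf Hf' : ℝ → ℝ, (∀ σ, HasDerivAt Hf (Hf' σ) σ) ∧
      (∀ σ, Hf' σ * (Λ (r₀, σ) - M (r₀, σ)) = fderiv ℝ Λ (r₀, σ) (0, 1)) ∧ ∀ p : ℝ × ℝ, |Hf (s p)| ≤ H) :
    ∀ p q : ℝ × ℝ, r p = r q := by
  have hr1 : Differentiable ℝ r := hr.differentiable (by simp)
  have hx : ∀ p : ℝ × ℝ, fderiv ℝ r p (0, 1) = 0 :=
    transversal_derivative_eq_zero hr hs hΛ hPDE hPDEs hB hKx ha₀ hgnl hJ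
  have hz : ∀ p : ℝ × ℝ, fderiv ℝ r p (1, 0) = 0 := fun p => by
    have h := hPDE p
    rw [hx p, mul_zero, add_zero] at h
    exact h
  have hD : ∀ p : ℝ × ℝ, fderiv ℝ r p = 0 := fun p => by
    refine ContinuousLinearMap.ext fun v => ?_
    obtain ⟨a, b⟩ := v
    rw [Literature.Geometry.Riemannian.clm_prod_apply_eq, hx p, hz p]
    simp
  intro p q
  exact is_const_of_fderiv_eq_zero hr1 hD p q

end Summit.NavierStokesRegularity.NavierStokesRegularity.Theorems.PoloidalWindowDoorPoloidalWindowRigidityZShockRiemannInvariantLiouville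

end
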